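import Summits.QuantumFields.BalabanUV.T4Continuum.Support.ChainEndWords
import Summits.QuantumFields.BalabanUV.T4Continuum.Support.ChainEndContraction
import HarnessLib

/-!
# T⁴ programme, node NE3 — the kinematic refinement lemma, leaf R2 ASSEMBLED: EXACTNESS OF THE BLOCK-AVERAGE
# CONSTRAINT IS FREE (the chain-end fix)

NE3 prover lineage P1, gen 17 (cell `pub-balaban`, unit `b2b-balaban-t4-ne3-p1`, row NE3 OWNER; assigned technique:
implicit function ∕ contraction mapping); skeleton SKELETON-NE3-P1.md v1.1 §3 leaf R2.  Assembles leaf R2a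
(`ChainEndContraction.exists_chainEnd_fixedPoint`: one matrix contraction per coarse bond) with leaf R2b part 1
(`ChainEndWords.bavg_modify`: the average (42) of the chain-end-modified configuration at `(z, κ)` is
`exp(offLineX) · S · c z κ`) into the configuration-level statement, in any non-trivial C⋆-algebra `𝔸` (`M_N(ℂ)` with
the operator norm in the application):

**`rescale_bavg_modify_corrField_eq`** (§4).  Let `L ≥ 1`, `W` a `U(𝔸)`-valued fine configuration on `ℤ^d` in the
small-field class `|W(∂p) − 1| ≤ a` with `512(d+1)(d+4)L²a ≤ 1`, and `U` a `U(𝔸)`-valued coarse configuration with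
MISMATCH `‖U(c) − \bar W(c)‖ ≤ δ` at every coarse bond.  Put `g = gap d L = 1 − L^{−d}(L^d − L)` (`= L^{1−d}` for
`d ≥ 1`, `gap_eq`) and assume `4(16(d+1)(d+4)L²a + 2δ/g) ≤ g`.  Then the CANONICAL correction field
`corrField L W U (2δ/g)` (§3: at each coarse bond the fixed point of leaf R2a for the local data — off-line loop variables,
chain product, target) is `U(𝔸)`-valued, within `2δ/g` of `1`, and
  `rescale L (bavg L (modify L W (corrField L W U (2δ/g)))) = U`   — EXACTLY.
So an APPROXIMATE refinement (leaf R1) can always be made exact at the cost `2δ/g = 2L^{d−1}δ` on the chain-end bonds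
only; the induced small-field ∕ flux-gradient perturbations are bond-local (skeleton §3 R0).

§1 the gap; §2 the bridge `offLineX = chainX` between the word-level exponent of R2b and the abstract exponent of R2a
(`U(𝔸)`-valued units have `u⁻¹ = u⋆`), and `\bar W(c) = exp(chainX … 1) · S`; §3 the canonical chooser `corr` ∕
`corrField`; §4 the theorem.

HONEST FRAMING.  Elementary: Banach fixed point + word bookkeeping; no estimate of the cell, no conditional
(`BetaPertH`, (B), (B^μ)) used or hidden; nothing bears on infinite volume, a mass gap, or the Clay problem; **NE3 is
NOT proved** (this closes leaf R2 of the kinematic lemma `SmoothRefine` up to the bond-local perturbation bookkeeping of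
R0; leaf R1, the approximate covariant refinement, remains OPEN and is OURS).  ABSOLUTE RULE kept: no printed sentence is
a hypothesis of any declaration; no `sorry`, no axioms beyond Mathlib's.  PLACEMENT (human rule 2026-08-19): cell work
under `Summits/QuantumFields/BalabanUV/`; imports this lineage's `ChainEndWords` ∕ `ChainEndContraction` only.
-/

set_option autoImplicit false

open scoped BigOperators
open NormedSpace

namespace Summit.QuantumFields.BalabanUV.T4Continuum.ChainEndFix

open Literature.MathematicalPhysics.QuantumFieldTheory.Balaban1983to89
open B7Prop1Explicit B7Prop2Explicit ChainEndWords ChainEndContraction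

noncomputable section

variable {d : ℕ}

/-! ## §1 The number of off-line offsets and the gap of the per-bond contraction -/

/-- The number of off-line offsets: `#offLine = L^d − L` (the on-line ones are the `L` multiples of `e_κ` in the
block). [folklore] -/
theorem card_offLine (L : ℕ) (κ : Fin d) : (offLine d L κ).card = L ^ d - L := by
  classical
  -- on-line offsets ↔ `Fin L` via `r ↦ r κ`
  have hon : (Finset.univ.filter fun r : Fin d → Fin L => ¬ ∃ ν, ν ≠ κ ∧ (r ν : ℕ) ≠ 0).card = L := by
    rcases Nat.eq_zero_or_pos L with hL | hL
    · subst hL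
      have : IsEmpty (Fin d → Fin 0) := ⟨fun r => Fin.elim0 (r κ)⟩
      simp [Finset.univ_eq_empty]
    · let f : Fin L → (Fin d → Fin L) := fun j ν => if ν = κ then j else ⟨0, hL⟩
      have hf : Function.Injective f := fun j j' h => by
        have := congrFun h κ; simpa [f] using this
      have himage : Finset.univ.filter (fun r : Fin d → Fin L => ¬ ∃ ν, ν ≠ κ ∧ (r ν : ℕ) ≠ 0)
          = Finset.univ.image f := by
        ext r
        simp only [Finset.mem_filter, Finset.mem_univ, true_and, Finset.mem_image, not_exists, not_and, not_not]
        constructor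
        · intro h
          refine ⟨r κ, funext fun ν => ?_⟩
          by_cases hν : ν = κ
          · subst hν; simp [f]
          · simp only [f, hν, if_false]; exact Fin.ext (h ν hν).symm
        · rintro ⟨j, rfl⟩ ν hν
          simp [f, hν]
      rw [himage, Finset.card_image_of_injective _ hf, Finset.card_univ, Fintype.card_fin]
  have htot : (Finset.univ : Finset (Fin d → Fin L)).card = L ^ d := by
    rw [Finset.card_univ, Fintype.card_fun, Fintype.card_fin, Fintype.card_fin]
  have hsplit := Finset.card_filter_add_card_filter_not
    (s := (Finset.univ : Finset (Fin d → Fin L))) (fun r : Fin d → Fin L => ∃ ν, ν ≠ κ ∧ (r ν : ℕ) ≠ 0)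
  rw [hon, htot] at hsplit
  unfold offLine
  omega


/-- The gap `g = 1 − L^{−d}·#offLine = 1 − L^{−d}(L^d − L)`. [folklore] -/
def gap (d L : ℕ) : ℝ := 1 - ((L : ℝ) ^ d)⁻¹ * ((L ^ d - L : ℕ) : ℝ)

/-- `gap d L = L / L^d` (`= L^{1−d}`) for `L, d ≥ 1`. [folklore] -/
theorem gap_eq {L : ℕ} (hL : 1 ≤ L) (hd : 1 ≤ d) : gap d L = (L : ℝ) / (L : ℝ) ^ d := by
  have hLd : L ≤ L ^ d := by
    calc L = L ^ 1 := (pow_one L).symm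
      _ ≤ L ^ d := Nat.pow_le_pow_right hL hd
  have hL0 : (0 : ℝ) < (L : ℝ) ^ d := by positivity
  unfold gap
  rw [Nat.cast_sub hLd, Nat.cast_pow]
  field_simp
  ring

/-- `0 < gap d L ≤ 1` for `L ≥ 1`. [folklore] -/
theorem gap_pos {L : ℕ} (hL : 1 ≤ L) : 0 < gap d L ∧ gap d L ≤ 1 := by
  rcases Nat.eq_zero_or_pos d with hd | hd
  · subst hd
    simp [gap, Nat.sub_eq_zero_of_le hL]
  · rw [gap_eq hL hd]
    have hL1 : (1 : ℝ) ≤ L := by exact_mod_cast hL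
    have hLd : (L : ℝ) ≤ (L : ℝ) ^ d := by
      calc (L : ℝ) = (L : ℝ) ^ 1 := (pow_one _).symm
        _ ≤ (L : ℝ) ^ d := pow_le_pow_right₀ hL1 hd
    exact ⟨by positivity, (div_le_one (by positivity)).mpr hLd⟩

/-- `L^{−d} · #(offLine as a type) = 1 − gap d L`. [folklore] -/
theorem lam_mul_card {L : ℕ} (κ : Fin d) :
    ((L : ℝ) ^ d)⁻¹ * Fintype.card (offLine d L κ) = 1 - gap d L := by
  rw [Fintype.card_coe, card_offLine, gap]; ring

/-! ## §2 The bridge between the word-level and the abstract exponent -/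

section Bridge

variable {𝔸 : Type*} [CStarAlgebra 𝔸]

/-- The inverse of a `U(𝔸)`-valued unit is its adjoint. [folklore] -/
theorem val_inv_eq_star {u : 𝔸ˣ} (hu : u ∈ unitaryUnits 𝔸) : ((u⁻¹ : 𝔸ˣ) : 𝔸) = star (u : 𝔸) := by
  have h : (u : 𝔸) * star (u : 𝔸) = 1 := Unitary.mul_star_self_of_mem hu
  calc ((u⁻¹ : 𝔸ˣ) : 𝔸) = ((u⁻¹ : 𝔸ˣ) : 𝔸) * ((u : 𝔸) * star (u : 𝔸)) := by rw [h, mul_one]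
    _ = star (u : 𝔸) := by rw [← mul_assoc, Units.inv_mul, one_mul]

/-- THE LOCAL DATA of the coarse bond `(z, κ)`: the off-line loop variables `w_r = W(Γ_{c,x})W(c)⁻¹` of (42). [folklore] -/
def loopData (L : ℕ) (W : Site d → Fin d → 𝔸ˣ) (z : Site d) (κ : Fin d) : offLine d L κ → 𝔸 :=
  fun i => ((Wcx L W ((L : ℤ) • z) κ (boxVec L i.1) : 𝔸ˣ) : 𝔸)

/-- **`offLineX = chainX`**: for `U(𝔸)`-valued `W` and `c`, the word-level off-line exponent of `ChainEndWords` is the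
abstract exponent of `ChainEndContraction` at the local data (`S⁻¹ = S⋆`, `(c z κ)⁻¹ = (c z κ)⋆`). [folklore] -/
theorem offLineX_eq_chainX {L : ℕ} {W c : Site d → Fin d → 𝔸ˣ} (hW : ∀ y μ, W y μ ∈ unitaryUnits 𝔸)
    (hc : ∀ z μ, c z μ ∈ unitaryUnits 𝔸) (z : Site d) (κ : Fin d) :
    offLineX L W c z κ
      = chainX (((L : ℝ) ^ d)⁻¹) (loopData L W z κ) ((chainProd L W z κ : 𝔸ˣ) : 𝔸) ((c z κ : 𝔸ˣ) : 𝔸) := by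
  unfold offLineX chainX
  rw [Finset.smul_sum, ← Finset.sum_coe_sort]
  refine Finset.sum_congr rfl fun i _ => ?_
  congr 1
  have hS : chainProd L W z κ ∈ unitaryUnits 𝔸 := hol_mem_of hW _ _
  simp only [twistedWcx, twist, loopData, Units.val_mul, val_inv_eq_star (hc z κ), val_inv_eq_star hS]

/-- The trivial correction field changes nothing. [folklore] -/
theorem modify_one (L : ℕ) (W : Site d → Fin d → 𝔸ˣ) : ChainEndWords.modify L W (fun _ _ => 1) = W := by
  funext y μ
  simp [ChainEndWords.modify]

/-- **`\bar W(c) = exp(chainX … 1) · S`**: the unmodified average at `(z, κ)` in the abstract vocabulary. [folklore] -/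
theorem val_bavg_eq {L : ℕ} (hL : 1 ≤ L) {W : Site d → Fin d → 𝔸ˣ} (hW : ∀ y μ, W y μ ∈ unitaryUnits 𝔸)
    (z : Site d) (κ : Fin d) :
    ((bavg L W ((L : ℤ) • z) κ : 𝔸ˣ) : 𝔸)
      = exp (chainX (((L : ℝ) ^ d)⁻¹) (loopData L W z κ) ((chainProd L W z κ : 𝔸ˣ) : 𝔸) 1)
          * ((chainProd L W z κ : 𝔸ˣ) : 𝔸) := by
  have h1 : ∀ z' μ, (fun (_ : Site d) (_ : Fin d) => (1 : 𝔸ˣ)) z' μ ∈ unitaryUnits 𝔸 :=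
    fun _ _ => (unitaryUnits 𝔸).one_mem
  have hb := bavg_modify hL W (fun _ _ => (1 : 𝔸ˣ)) z κ
  rw [modify_one] at hb
  rw [hb, Units.val_mul, Units.val_mul, val_expUnit, offLineX_eq_chainX hW h1, Units.val_one, mul_one]

end Bridge

/-! ## §3 The canonical chooser -/

section Chooser

variable {𝔸 : Type*} [CStarAlgebra 𝔸]

/-- The canonical chain-end correction for abstract local data: SOME unitary `c` within `ρ` of `1` solving
`exp(X(c)) · s · c = u` if one exists, else `1`. A FUNCTION of the data (so periodic data give periodic corrections).
[folklore] -/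
def corr {ι : Type*} [Fintype ι] (lam ρ : ℝ) (w : ι → 𝔸) (s u : 𝔸) : 𝔸 := by
  classical
  exact if h : ∃ c ∈ unitary 𝔸, ‖c - 1‖ ≤ ρ ∧ exp (chainX lam w s c) * s * c = u then Classical.choose h else 1

/-- `corr` is unitary. [folklore] -/
theorem corr_mem_unitary {ι : Type*} [Fintype ι] (lam ρ : ℝ) (w : ι → 𝔸) (s u : 𝔸) :
    corr lam ρ w s u ∈ unitary 𝔸 := by
  unfold corr; split_ifs with h
  · exact (Classical.choose_spec h).1
  · exact Submonoid.one_mem _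

/-- When a solution exists, `corr` is one. [folklore] -/
theorem corr_spec {ι : Type*} [Fintype ι] {lam ρ : ℝ} {w : ι → 𝔸} {s u : 𝔸}
    (h : ∃ c ∈ unitary 𝔸, ‖c - 1‖ ≤ ρ ∧ exp (chainX lam w s c) * s * c = u) :
    ‖corr lam ρ w s u - 1‖ ≤ ρ ∧ exp (chainX lam w s (corr lam ρ w s u)) * s * corr lam ρ w s u = u := by
  have hc : corr lam ρ w s u = Classical.choose h := by
    unfold corr
    split_ifs with h'
    · rfl
    · exact absurd h h'
  rw [hc]
  exact (Classical.choose_spec h).2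

/-- A unitary element as a unit. [folklore] -/
def unitOf (c : 𝔸) (hc : c ∈ unitary 𝔸) : 𝔸ˣ :=
  ⟨c, star c, Unitary.mul_star_self_of_mem hc, Unitary.star_mul_self_of_mem hc⟩

/-- `unitOf` has the given value. [folklore] -/
@[simp] theorem val_unitOf (c : 𝔸) (hc : c ∈ unitary 𝔸) : (unitOf c hc : 𝔸) = c := rfl

/-- **THE CANONICAL CORRECTION FIELD**: at each coarse bond `(z, κ)`, `corr` of the local data (off-line loop variables,
chain product, target `U z κ`) with radius `ρ`. [folklore] -/
def corrField (L : ℕ) (W U : Site d → Fin d → 𝔸ˣ) (ρ : ℝ) : Site d → Fin d → 𝔸ˣ :=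
  fun z κ => unitOf (corr (((L : ℝ) ^ d)⁻¹) ρ (loopData L W z κ) ((chainProd L W z κ : 𝔸ˣ) : 𝔸) ((U z κ : 𝔸ˣ) : 𝔸))
    (corr_mem_unitary _ _ _ _ _)

/-- The correction field is `U(𝔸)`-valued. [folklore] -/
theorem corrField_mem (L : ℕ) (W U : Site d → Fin d → 𝔸ˣ) (ρ : ℝ) (z : Site d) (κ : Fin d) :
    corrField L W U ρ z κ ∈ unitaryUnits 𝔸 :=
  corr_mem_unitary _ _ (loopData L W z κ) _ _

end Chooser

/-! ## §4 The theorem: exactness of the block-average constraint by the chain-end fix -/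

section Main

variable {𝔸 : Type*} [CStarAlgebra 𝔸] [Nontrivial 𝔸]

omit [Nontrivial 𝔸] in
/-- The off-line loop variables of a `U(𝔸)`-valued configuration are unitary. [folklore] -/
theorem loopData_mem {L : ℕ} {W : Site d → Fin d → 𝔸ˣ} (hW : ∀ y μ, W y μ ∈ unitaryUnits 𝔸) (z : Site d)
    (κ : Fin d) (i : offLine d L κ) : loopData L W z κ i ∈ unitary 𝔸 :=
  (unitaryUnits 𝔸).mul_mem (hol_mem_of hW _ _) ((unitaryUnits 𝔸).inv_mem (hol_mem_of hW _ _))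

/-- … and within `16(d+1)(d+4)L²a` of `1` in the small-field class (B7 p. 25, tree `norm_Wcx_sub_one_le`).
[cite: Balaban1985Averaging, p.25] -/
theorem norm_loopData_sub_one_le {L : ℕ} (hL : 1 ≤ L) {W : Site d → Fin d → 𝔸ˣ}
    (hW : ∀ y μ, W y μ ∈ unitaryUnits 𝔸) {a : ℝ} (ha : 0 ≤ a)
    (hsmall : 512 * (d + 1) * (d + 4) * (L : ℝ) ^ 2 * a ≤ 1)
    (h44 : ∀ (x : Site d) (κ κ' : Fin d), κ ≠ κ' → ‖((hol W x (plaqWord κ κ') : 𝔸ˣ) : 𝔸) - 1‖ ≤ a)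
    (z : Site d) (κ : Fin d) (i : offLine d L κ) :
    ‖loopData L W z κ i - 1‖ ≤ 2 * (8 * (d + 1) * (d + 4) * (L : ℝ) ^ 2 * a) :=
  norm_Wcx_sub_one_le L hL W (fun x μ => unitaryUnits_le_U1 (hW x μ)) ha hsmall h44 _ κ i.1

/-- **PER-BOND SOLVABILITY**: under the hypotheses of the theorem, at every coarse bond the exactness equation has a
unitary solution within `2δ/g` of `1` (leaf R2a applied to the local data). [folklore] -/
theorem exists_local_solution {L : ℕ} (hL : 1 ≤ L) {W U : Site d → Fin d → 𝔸ˣ}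
    (hW : ∀ y μ, W y μ ∈ unitaryUnits 𝔸) (hU : ∀ z κ, U z κ ∈ unitaryUnits 𝔸) {a δ : ℝ} (ha : 0 ≤ a) (hδ : 0 ≤ δ)
    (hsmall : 512 * (d + 1) * (d + 4) * (L : ℝ) ^ 2 * a ≤ 1)
    (h44 : ∀ (x : Site d) (κ κ' : Fin d), κ ≠ κ' → ‖((hol W x (plaqWord κ κ') : 𝔸ˣ) : 𝔸) - 1‖ ≤ a)
    (hmis : ∀ (z : Site d) (κ : Fin d), ‖((U z κ : 𝔸ˣ) : 𝔸) - ((bavg L W ((L : ℤ) • z) κ : 𝔸ˣ) : 𝔸)‖ ≤ δ)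
    (hgap : 4 * (2 * (8 * (d + 1) * (d + 4) * (L : ℝ) ^ 2 * a) + 2 * δ / gap d L) ≤ gap d L)
    (z : Site d) (κ : Fin d) :
    ∃ c ∈ unitary 𝔸, ‖c - 1‖ ≤ 2 * δ / gap d L ∧
      exp (chainX (((L : ℝ) ^ d)⁻¹) (loopData L W z κ) ((chainProd L W z κ : 𝔸ˣ) : 𝔸) c)
        * ((chainProd L W z κ : 𝔸ˣ) : 𝔸) * c = ((U z κ : 𝔸ˣ) : 𝔸) := by
  have hlam : (0 : ℝ) ≤ ((L : ℝ) ^ d)⁻¹ := by positivity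
  have hgap' : 1 - ((L : ℝ) ^ d)⁻¹ * Fintype.card (offLine d L κ) = gap d L := by rw [lam_mul_card]; ring
  have hκ : ((L : ℝ) ^ d)⁻¹ * Fintype.card (offLine d L κ) < 1 := by
    have := (gap_pos (d := d) hL).1; linarith
  have hS : chainProd L W z κ ∈ unitaryUnits 𝔸 := hol_mem_of hW _ _
  have hmis' : ‖((U z κ : 𝔸ˣ) : 𝔸)
      - exp (chainX (((L : ℝ) ^ d)⁻¹) (loopData L W z κ) ((chainProd L W z κ : 𝔸ˣ) : 𝔸) 1)
          * ((chainProd L W z κ : 𝔸ˣ) : 𝔸)‖ ≤ δ := by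
    rw [← val_bavg_eq hL hW]; exact hmis z κ
  have hsm : 4 * (2 * (8 * (d + 1) * (d + 4) * (L : ℝ) ^ 2 * a)
      + 2 * δ / (1 - ((L : ℝ) ^ d)⁻¹ * Fintype.card (offLine d L κ)))
        ≤ 1 - ((L : ℝ) ^ d)⁻¹ * Fintype.card (offLine d L κ) := by
    rw [hgap']; exact hgap
  obtain ⟨c, hcu, hcρ, hceq⟩ := exists_chainEnd_fixedPoint hlam hκ (by positivity) hδ
    (loopData_mem hW z κ) (norm_loopData_sub_one_le hL hW ha hsmall h44 z κ) hS (hU z κ) hmis' hsm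
  rw [hgap'] at hcρ
  exact ⟨c, hcu, hcρ, hceq⟩

/-- **EXACTNESS OF THE BLOCK-AVERAGE CONSTRAINT BY THE CHAIN-END FIX** (leaf R2 of the kinematic refinement lemma).
`L ≥ 1`; `W` a `U(𝔸)`-valued fine configuration with `|W(∂p) − 1| ≤ a`, `512(d+1)(d+4)L²a ≤ 1`; `U` a `U(𝔸)`-valued
coarse configuration with mismatch `‖U(c) − \bar W(c)‖ ≤ δ` at every coarse bond; `4(16(d+1)(d+4)L²a + 2δ/g) ≤ g`,
`g = gap d L` (`= L^{1−d}`).  Then the canonical correction field `c = corrField L W U (2δ/g)` is `U(𝔸)`-valued, within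
`2δ/g` of `1` at every coarse bond, and the chain-end-modified configuration averages EXACTLY onto `U`:
`rescale L (bavg L (modify L W c)) = U`. [folklore] -/
theorem rescale_bavg_modify_corrField_eq {L : ℕ} (hL : 1 ≤ L) {W U : Site d → Fin d → 𝔸ˣ}
    (hW : ∀ y μ, W y μ ∈ unitaryUnits 𝔸) (hU : ∀ z κ, U z κ ∈ unitaryUnits 𝔸) {a δ : ℝ} (ha : 0 ≤ a) (hδ : 0 ≤ δ)
    (hsmall : 512 * (d + 1) * (d + 4) * (L : ℝ) ^ 2 * a ≤ 1)
    (h44 : ∀ (x : Site d) (κ κ' : Fin d), κ ≠ κ' → ‖((hol W x (plaqWord κ κ') : 𝔸ˣ) : 𝔸) - 1‖ ≤ a)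
    (hmis : ∀ (z : Site d) (κ : Fin d), ‖((U z κ : 𝔸ˣ) : 𝔸) - ((bavg L W ((L : ℤ) • z) κ : 𝔸ˣ) : 𝔸)‖ ≤ δ)
    (hgap : 4 * (2 * (8 * (d + 1) * (d + 4) * (L : ℝ) ^ 2 * a) + 2 * δ / gap d L) ≤ gap d L) :
    (∀ z κ, corrField L W U (2 * δ / gap d L) z κ ∈ unitaryUnits 𝔸) ∧
    (∀ z κ, ‖((corrField L W U (2 * δ / gap d L) z κ : 𝔸ˣ) : 𝔸) - 1‖ ≤ 2 * δ / gap d L) ∧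
    rescale L (bavg L (ChainEndWords.modify L W (corrField L W U (2 * δ / gap d L)))) = U := by
  set ρ : ℝ := 2 * δ / gap d L with hρ
  have hsol : ∀ z κ, ‖((corrField L W U ρ z κ : 𝔸ˣ) : 𝔸) - 1‖ ≤ ρ ∧
      exp (chainX (((L : ℝ) ^ d)⁻¹) (loopData L W z κ) ((chainProd L W z κ : 𝔸ˣ) : 𝔸)
          ((corrField L W U ρ z κ : 𝔸ˣ) : 𝔸)) * ((chainProd L W z κ : 𝔸ˣ) : 𝔸)
        * ((corrField L W U ρ z κ : 𝔸ˣ) : 𝔸) = ((U z κ : 𝔸ˣ) : 𝔸) := fun z κ =>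
    corr_spec (exists_local_solution hL hW hU ha hδ hsmall h44 hmis hgap z κ)
  refine ⟨corrField_mem L W U ρ, fun z κ => (hsol z κ).1, ?_⟩
  funext z κ
  apply Units.ext
  rw [rescale_bavg_modify hL, Units.val_mul, Units.val_mul, val_expUnit,
    offLineX_eq_chainX hW (corrField_mem L W U ρ), ← mul_assoc]
  exact (hsol z κ).2

end Main

/-! ## §5 Translation covariance: periodic data give a periodic correction field -/

section Shift

variable {G : Type*} [Group G]

/-- Holonomies of a `t`-invariant configuration are `t`-invariant (general group version of the tree's
`AveragingDeficitLiftPeriodic.hol_shift`). [folklore] -/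
theorem hol_shift_of_invariant {W : Site d → Fin d → G} {t : Site d} (h : ∀ (x : Site d) (μ : Fin d), W (x + t) μ = W x μ) :
    ∀ (x : Site d) (w : List (Letter d)), hol W (x + t) w = hol W x w
  | x, [] => by simp
  | x, l :: w => by
    rw [hol_cons, hol_cons, show x + t + l.vec = (x + l.vec) + t by abel, hol_shift_of_invariant h (x + l.vec) w]
    congr 1
    obtain ⟨μ, b⟩ := l
    cases b
    · rw [stepHol_false, stepHol_false, show x + t - e μ = (x - e μ) + t by abel, h]
    · rw [stepHol_true, stepHol_true, h]

end Shift

section ShiftAlgebra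

variable {𝔸 : Type*} [CStarAlgebra 𝔸]

/-- The loop variables of (42) of an `(L·t)`-invariant configuration are `t`-invariant in the coarse variable. [folklore] -/
theorem loopData_shift {L : ℕ} {W : Site d → Fin d → 𝔸ˣ} {t : Site d}
    (h : ∀ (x : Site d) (μ : Fin d), W (x + (L : ℤ) • t) μ = W x μ) (z : Site d) (κ : Fin d) :
    loopData L W (z + t) κ = loopData L W z κ := by
  funext i
  simp only [loopData, Wcx, smul_add, hol_shift_of_invariant h]

/-- … and so is the chain product. [folklore] -/
theorem chainProd_shift {L : ℕ} {W : Site d → Fin d → 𝔸ˣ} {t : Site d}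
    (h : ∀ (x : Site d) (μ : Fin d), W (x + (L : ℤ) • t) μ = W x μ) (z : Site d) (κ : Fin d) :
    chainProd L W (z + t) κ = chainProd L W z κ := by
  simp only [chainProd, smul_add, hol_shift_of_invariant h]

/-- **PERIODIC DATA GIVE A PERIODIC CORRECTION FIELD**: if `W` is `(L·t)`-invariant and `U` is `t`-invariant then
`corrField L W U ρ` is `t`-invariant (it is a FUNCTION of the local data). [folklore] -/
theorem corrField_shift {L : ℕ} {W U : Site d → Fin d → 𝔸ˣ} {t : Site d} (ρ : ℝ)
    (hW : ∀ (x : Site d) (μ : Fin d), W (x + (L : ℤ) • t) μ = W x μ)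
    (hU : ∀ (z : Site d) (κ : Fin d), U (z + t) κ = U z κ) (z : Site d) (κ : Fin d) :
    corrField L W U ρ (z + t) κ = corrField L W U ρ z κ := by
  apply Units.ext
  simp only [corrField, val_unitOf, loopData_shift hW, chainProd_shift hW, hU]

end ShiftAlgebra

end

end Summit.QuantumFields.BalabanUV.T4Continuum.ChainEndFix
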